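import Mathlib
import Summits.NavierStokesRegularity.OSWSelfSimilar.SheetNSLineTorusCascadeSynthesis
import Summits.NavierStokesRegularity.OSWSelfSimilar.SheetNSLineTorusCascadeLink
import Summits.NavierStokesRegularity.OSWSelfSimilar.SheetNSLineTorusCascadeModes
import HarnessLib

/-!
# Viscous CLM on the torus (`a = 0`, `σ = 2`): classical solutions from the sine datum are UNIQUE, ODD, and — for
# `0 ≤ c < 12ν` — they ARE the synthesized global solution

HONEST FRAMING (cell ns-blowup GROUP B «PROFILE SEARCH», zone Z3, row Z3-U addendum A-F2 of `HOME/profile/z3/CENSUS-Z3.md`;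
human rulings D-0035/D-0074): **1-D MODEL (viscous Constantin–Lax–Majda equation `ω_t = ω·Hω + ν ω_xx` on `𝕋`,
`H = hilbertTransformCircle`); kernel-checked; not Euler, not Navier–Stokes; «violates: none — MODEL».**

Closes the «no uniqueness statement» caveat of the link / synthesis files (`SheetNSLineTorusCascadeLink`,
`SheetNSLineTorusCascadeSynthesis`): a classical solution (`IsClassicalSolution`) is determined by its window modes (pointwise
Fourier inversion of a `C²` slice), the modes from the sine datum form a sine cascade (`isSineCascadeOn_coef_re`,
`coef_im_eq_zero`), and finite-horizon sine cascades are unique (canonical extension + `IsSineCascade.unique` of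
`SheetNSLineTorusCascadeExistence`). Contents:

* `IsSineCascadeOn.unique` — two finite-horizon sine cascades (`T > 0`) agree on `[0, T]`;
* `modeCoeff_neg_of_real` — for a real slice, `mode (−n) = conj (mode n)`;
* `mode_natCast_eq`, `mode_neg_natCast_eq` — the window modes (all `n ∈ ℤ`) of a classical solution from `−c sin x` are
  determined by the real cascade variables `Re c_k` (`k ∈ ℕ`): `mode k = iπ·Re c_k`, `mode (−k) = conj (mode k)`;
* **`IsClassicalSolution.unique_of_sine`** — two classical solutions on `[0, T]` from the same datum `−c sin x` coincide on
  `[0, T] × ℝ`;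
* **`IsClassicalSolution.odd`** — every classical solution from `−c sin x` is odd in `x` at every time in `[0, T]`;
* **`IsClassicalSolution.eq_synth_of_lt_twelve`** — for `0 < ν`, `0 ≤ c < 12ν`, `T > 0`: every classical solution on `[0,T]`
  from `−c sin x` IS (on `[0,T] × ℝ`) the synthesized global solution `synthOmega (cascadeSolution ν (sineDatum c))`; with
  `exists_global_classicalSolution_of_lt_twelve` this reads: **the classical solution from `−c sin x` exists globally and is
  unique** (MODEL).

bears_on: LADDER-NS N5 / zone Z3 (row Z3-U, A-F2) → N1 linear core. WHAT THIS IS NOT: not NS; uniqueness WITHIN the classical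
class only (no weak/B₀ solutions); nothing about the threshold value.
-/

noncomputable section

namespace Summit.NavierStokesRegularity.OSWSelfSimilar
namespace SheetNSLineTorusCascade

open Finset Real Set Filter MeasureTheory intervalIntegral Complex
open Literature.Analysis.Fourier
open scoped Topology

variable {ν c T : ℝ}

/-! ### Finite-horizon cascades are unique -/

/-- **Two finite-horizon sine cascades with the same `ν`, `c` agree on `[0, T]`** (`T > 0`): both are restrictions of global
cascades (`exists_extend`), and global sine cascades are unique (`IsSineCascade.unique`). [new here — MODEL] -/
theorem IsSineCascadeOn.unique {e₁ e₂ : ℕ → ℝ → ℝ} (h₁ : IsSineCascadeOn ν c T e₁) (h₂ : IsSineCascadeOn ν c T e₂)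
    (hT : 0 < T) : ∀ k : ℕ, ∀ t ∈ Icc (0 : ℝ) T, e₁ k t = e₂ k t := by
  obtain ⟨E₁, hE₁, hE₁e⟩ := h₁.exists_extend hT
  obtain ⟨E₂, hE₂, hE₂e⟩ := h₂.exists_extend hT
  intro k t ht
  rw [← hE₁e k t ht, ← hE₂e k t ht]
  exact hE₁.unique hE₂ k t ht.1

/-! ### Real slices: negative modes are conjugates -/

/-- For a real-valued `g`, `modeCoeff T (−n) g = conj (modeCoeff T n g)`. [folklore; Katznelson I §1.4 Theorem (c)] -/
theorem modeCoeff_neg_of_real (L : ℝ) (n : ℤ) (g : ℝ → ℝ) :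
    modeCoeff L (-n) (fun x => ((g x : ℝ) : ℂ)) = (starRingEnd ℂ) (modeCoeff L n (fun x => ((g x : ℝ) : ℂ))) := by
  unfold modeCoeff
  have hconj : (starRingEnd ℂ) (∫ φ in (0:ℝ)..L, fourier (-n) (φ : AddCircle L) * ((g φ : ℝ) : ℂ))
      = ∫ φ in (0:ℝ)..L, (starRingEnd ℂ) (fourier (-n) (φ : AddCircle L) * ((g φ : ℝ) : ℂ)) := by
    simp only [intervalIntegral, map_sub, ← integral_conj]
  rw [hconj]
  refine intervalIntegral.integral_congr fun φ _ => ?_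
  simp only [map_mul, Complex.conj_ofReal, neg_neg]
  rw [fourier_neg, Complex.conj_conj]

/-! ### The modes of a classical solution from the sine datum are determined by the real cascade variables -/

section sine

variable {ω ωt ωx ωxx : ℝ → ℝ → ℝ} (h : IsClassicalSolution ν T ω ωt ωx ωxx) (hω0 : ∀ x, ω 0 x = -c * Real.sin x)
include h hω0

/-- For `k ∈ ℕ`, `mode ω k t = i·π·Re c_k(t)` on `[0, T]` (the imaginary part of `c_k` vanishes). [new here — MODEL] -/
theorem mode_natCast_eq {t : ℝ} (ht : t ∈ Icc (0 : ℝ) T) (k : ℕ) :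
    mode ω (k : ℤ) t = I * π * (((coef ω k t).re : ℝ) : ℂ) := by
  have hre : (((coef ω k t).re : ℝ) : ℂ) = coef ω k t := by
    apply Complex.ext
    · simp
    · simp [coef_im_eq_zero h hω0 k t ht]
  rw [hre, coef]
  have hπ : (π : ℂ) ≠ 0 := by exact_mod_cast Real.pi_ne_zero
  field_simp
  rw [Complex.I_sq]
  ring

omit h hω0 in
/-- For `k ∈ ℕ`, `mode ω (−k) t = conj (mode ω k t)` (any real slice). -/
theorem mode_neg_natCast_eq {t : ℝ} (k : ℕ) : mode ω (-(k : ℤ)) t = (starRingEnd ℂ) (mode ω (k : ℤ) t) := by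
  unfold mode
  exact modeCoeff_neg_of_real (2 * π) (k : ℤ) (ω t)

end sine

/-! ### Uniqueness and oddness -/

/-- **Uniqueness of classical solutions from the sine datum.** Two classical solutions of the viscous CLM on `[0, T] × ℝ`
(`T > 0`) with `ω₁(0,·) = ω₂(0,·) = −c sin` coincide on `[0, T] × ℝ`. [new here — MODEL] -/
theorem IsClassicalSolution.unique_of_sine {ω₁ ωt₁ ωx₁ ωxx₁ ω₂ ωt₂ ωx₂ ωxx₂ : ℝ → ℝ → ℝ}
    (h₁ : IsClassicalSolution ν T ω₁ ωt₁ ωx₁ ωxx₁) (h₂ : IsClassicalSolution ν T ω₂ ωt₂ ωx₂ ωxx₂)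
    (hω₁ : ∀ x, ω₁ 0 x = -c * Real.sin x) (hω₂ : ∀ x, ω₂ 0 x = -c * Real.sin x) (hT : 0 < T)
    {t : ℝ} (ht : t ∈ Icc (0 : ℝ) T) (x : ℝ) : ω₁ t x = ω₂ t x := by
  haveI : Fact (0 < 2 * π) := ⟨by positivity⟩
  -- the real cascade variables agree
  have hcoef : ∀ k : ℕ, (coef ω₁ k t).re = (coef ω₂ k t).re :=
    fun k => (isSineCascadeOn_coef_re h₁ hω₁ hT).unique (isSineCascadeOn_coef_re h₂ hω₂ hT) hT k t ht
  -- hence all window modes agree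
  have hmode : ∀ n : ℤ, mode ω₁ n t = mode ω₂ n t := by
    intro n
    rcases Int.eq_nat_or_neg n with ⟨k, rfl | rfl⟩
    · rw [mode_natCast_eq h₁ hω₁ ht k, mode_natCast_eq h₂ hω₂ ht k, hcoef k]
    · rw [mode_neg_natCast_eq (ω := ω₁) k, mode_neg_natCast_eq (ω := ω₂) k, mode_natCast_eq h₁ hω₁ ht k,
        mode_natCast_eq h₂ hω₂ ht k, hcoef k]
  -- pointwise inversion of both slices
  have hs₁ := hasSum_modeCoeff_mul_fourier (T := 2 * π) (f := fun y => ((ω₁ t y : ℝ) : ℂ))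
    (continuous_ofReal.comp (continuous_slice h₁ ht)) (fun y => by simp [(h₁.periodic t ht) y])
    (summable_norm_mode h₁ ht) x
  have hs₂ := hasSum_modeCoeff_mul_fourier (T := 2 * π) (f := fun y => ((ω₂ t y : ℝ) : ℂ))
    (continuous_ofReal.comp (continuous_slice h₂ ht)) (fun y => by simp [(h₂.periodic t ht) y])
    (summable_norm_mode h₂ ht) x
  have hfun : (fun n : ℤ => (((1 / (2 * π)) : ℝ) : ℂ) * modeCoeff (2 * π) n (fun y => ((ω₁ t y : ℝ) : ℂ))
      * fourier n (x : AddCircle (2 * π)))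
      = fun n : ℤ => (((1 / (2 * π)) : ℝ) : ℂ) * modeCoeff (2 * π) n (fun y => ((ω₂ t y : ℝ) : ℂ))
        * fourier n (x : AddCircle (2 * π)) := by
    funext n
    have := hmode n
    unfold mode at this
    rw [this]
  rw [hfun] at hs₁
  exact_mod_cast hs₁.unique hs₂

/-- **Classical solutions from the sine datum stay odd**: `ω(t, −x) = −ω(t, x)` on `[0, T]`. [new here — MODEL] -/
theorem IsClassicalSolution.odd {ω ωt ωx ωxx : ℝ → ℝ → ℝ} (h : IsClassicalSolution ν T ω ωt ωx ωxx)
    (hω0 : ∀ x, ω 0 x = -c * Real.sin x) {t : ℝ} (ht : t ∈ Icc (0 : ℝ) T) (x : ℝ) :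
    ω t (-x) = -ω t x := by
  haveI : Fact (0 < 2 * π) := ⟨by positivity⟩
  have hsum := hasSum_modeCoeff_mul_fourier (T := 2 * π) (f := fun y => ((ω t y : ℝ) : ℂ))
    (continuous_ofReal.comp (continuous_slice h ht)) (fun y => by simp [(h.periodic t ht) y])
    (summable_norm_mode h ht)
  have h1 := hsum (-x)
  have h2 := (hsum x).neg
  -- reindex `h1` by `n ↦ −n` and compare termwise with `h2`
  have h1' := (Equiv.neg ℤ).hasSum_iff.mpr h1
  have hterm : (fun n : ℤ => (((1 / (2 * π)) : ℝ) : ℂ) * modeCoeff (2 * π) n (fun y => ((ω t y : ℝ) : ℂ))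
      * fourier n (((-x : ℝ)) : AddCircle (2 * π))) ∘ (Equiv.neg ℤ)
      = fun n : ℤ => -((((1 / (2 * π)) : ℝ) : ℂ) * modeCoeff (2 * π) n (fun y => ((ω t y : ℝ) : ℂ))
        * fourier n (x : AddCircle (2 * π))) := by
    funext n
    simp only [Function.comp_apply, Equiv.neg_apply]
    -- the character: `e_{−n}(−x) = e_n(x)`
    have hchar : fourier (-n) (((-x : ℝ)) : AddCircle (2 * π)) = fourier n (x : AddCircle (2 * π)) := by
      rw [fourier_coe_apply, fourier_coe_apply]
      congr 1; push_cast; ring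
    -- the mode: `mode (−n) = conj (mode n) = −mode n` (purely imaginary)
    have hmode : modeCoeff (2 * π) (-n) (fun y => ((ω t y : ℝ) : ℂ)) = -modeCoeff (2 * π) n (fun y => ((ω t y : ℝ) : ℂ)) := by
      have himag : ∀ m : ℤ, (modeCoeff (2 * π) m (fun y => ((ω t y : ℝ) : ℂ))).re = 0 := by
        intro m
        rcases Int.eq_nat_or_neg m with ⟨k, rfl | rfl⟩
        · have := mode_natCast_eq h hω0 ht k
          unfold mode at this
          rw [this]
          simp
        · have := mode_neg_natCast_eq (ω := ω) (t := t) k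
          unfold mode at this
          rw [this, Complex.conj_re]
          have h3 := mode_natCast_eq h hω0 ht k
          unfold mode at h3
          rw [h3]
          simp
      rw [modeCoeff_neg_of_real]
      apply Complex.ext
      · simp [himag]
      · simp
    rw [hchar, hmode]
    ring
  rw [hterm] at h1'
  exact_mod_cast h1'.unique h2

/-- **For `0 ≤ c < 12ν` every classical solution from `−c sin x` IS the synthesized global one** (on its own horizon):
hence it extends to a global classical solution, and the classical solution from the sine datum exists globally and is
unique. [new here — MODEL] -/
theorem IsClassicalSolution.eq_synth_of_lt_twelve {ω ωt ωx ωxx : ℝ → ℝ → ℝ}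
    (h : IsClassicalSolution ν T ω ωt ωx ωxx) (hω0 : ∀ x, ω 0 x = -c * Real.sin x) (hν : 0 < ν) (hc : 0 ≤ c)
    (h12 : c < 12 * ν) (hT : 0 < T) {t : ℝ} (ht : t ∈ Icc (0 : ℝ) T) (x : ℝ) :
    ω t x = synthOmega (cascadeSolution ν (sineDatum c)) t x :=
  h.unique_of_sine (isClassicalSolution_of_lt_twelve hν hc h12 T) hω0 (synthOmega_cascadeSolution_zero c) hT ht x

/-- **Generic identification (appended).** For ANY global sine cascade `e` with a geometric envelope `|e_k(t)| ≤ A·k·q^k`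
(`0 ≤ q < 1`, all `t ≥ 0`; e.g. a certificate's envelope for `c` up to the certified global constant), every classical
solution on `[0, T]` (`T > 0`) from `−c sin x` IS the synthesized series `synthOmega e` on `[0, T] × ℝ` — so it extends to
the global classical solution `isClassicalSolution_synth` and is unique. [new here — MODEL] -/
theorem IsClassicalSolution.eq_synth_of_envelope {ω ωt ωx ωxx : ℝ → ℝ → ℝ} {e : ℕ → ℝ → ℝ} {A q : ℝ}
    (h : IsClassicalSolution ν T ω ωt ωx ωxx) (hω0 : ∀ x, ω 0 x = -c * Real.sin x)
    (he : IsSineCascade ν c e) (hA : 0 ≤ A) (hq : 0 ≤ q) (hq1 : q < 1)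
    (hb : ∀ k : ℕ, ∀ t : ℝ, 0 ≤ t → |e k t| ≤ A * k * q ^ k) (hT : 0 < T) {t : ℝ} (ht : t ∈ Icc (0 : ℝ) T)
    (x : ℝ) : ω t x = synthOmega e t x :=
  h.unique_of_sine (isClassicalSolution_synth he hA hq hq1 hb T) hω0 (synthOmega_zero_eq he) hT ht x

/-! ### Exact observables of every classical solution (appended) -/

/-- **Exact observable, mode 1.** For every classical solution on `[0, T]` (`T > 0`) from `−c sin x`:
`Re c_1(t) = c·e^{−νt}` on `[0, T]` — equivalently `∫₀^{2π} ω(t,x) sin x dx = −π c e^{−νt}`; a test invariant for the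
numerics, independent of blow-up (`mode_one` through the canonical extension). [new here — MODEL] -/
theorem IsClassicalSolution.coef_one_re_eq {ω ωt ωx ωxx : ℝ → ℝ → ℝ} (h : IsClassicalSolution ν T ω ωt ωx ωxx)
    (hω0 : ∀ x, ω 0 x = -c * Real.sin x) (hT : 0 < T) {t : ℝ} (ht : t ∈ Icc (0 : ℝ) T) :
    (coef ω 1 t).re = c * Real.exp (-(ν * t)) := by
  obtain ⟨E, hE, hEe⟩ := (isSineCascadeOn_coef_re h hω0 hT).exists_extend hT
  rw [← hEe 1 t ht]
  exact mode_one hE t ht.1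

/-- **Exact observable, mode 1, as a window mode:** `∫₀^{2π} e^{−ix} ω(t,x) dx = iπ c e^{−νt}`. [new here — MODEL] -/
theorem IsClassicalSolution.mode_one_eq {ω ωt ωx ωxx : ℝ → ℝ → ℝ} (h : IsClassicalSolution ν T ω ωt ωx ωxx)
    (hω0 : ∀ x, ω 0 x = -c * Real.sin x) (hT : 0 < T) {t : ℝ} (ht : t ∈ Icc (0 : ℝ) T) :
    mode ω 1 t = I * π * (((c * Real.exp (-(ν * t)) : ℝ)) : ℂ) := by
  rw [← h.coef_one_re_eq hω0 hT ht]
  exact mode_natCast_eq h hω0 ht 1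

/-- **Exact observable, mode 2.** For `ν ≠ 0`: `Re c_2(t) = c²·(e^{−2νt} − e^{−4νt})/(4ν)` on `[0, T]` (`T > 0`)
(`IsSineCascade.mode_two_eq` of `SheetNSLineTorusCascadeModes` through the canonical extension). [new here — MODEL] -/
theorem IsClassicalSolution.coef_two_re_eq {ω ωt ωx ωxx : ℝ → ℝ → ℝ} (h : IsClassicalSolution ν T ω ωt ωx ωxx)
    (hω0 : ∀ x, ω 0 x = -c * Real.sin x) (hν : ν ≠ 0) (hT : 0 < T) {t : ℝ} (ht : t ∈ Icc (0 : ℝ) T) :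
    (coef ω 2 t).re = c ^ 2 * (Real.exp (-(2 * ν * t)) - Real.exp (-(4 * ν * t))) / (4 * ν) := by
  obtain ⟨E, hE, hEe⟩ := (isSineCascadeOn_coef_re h hω0 hT).exists_extend hT
  rw [← hEe 2 t ht]
  exact hE.mode_two_eq hν ht.1

end SheetNSLineTorusCascade
end Summit.NavierStokesRegularity.OSWSelfSimilar
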